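import Literature.Analysis.FluidPDE.EulerTorusLocalExistence
import Literature.Analysis.FluidPDE.EulerTorusUniqueness
import Literature.Analysis.FluidPDE.OnsagerBDSVEulerApriori
import Literature.Analysis.FluidPDE.OnsagerBDSVPotentialTheoryProofs
import Literature.Analysis.FunctionSpaces.HolderLogConvexity
import HarnessLib

/-!
# Propagation of Hölder norms for smooth Euler solutions on `T³`: discharge of
`Torus.eulerHolderPropagation`

Analysis/FluidPDE proof file (sibling of `EulerTorusLocalExistence.lean`). The named fact
`Torus.eulerHolderPropagation`
(`EulerTorusLocalExistence.lean`; Buckmaster–De Lellis–Székelyhidi–Vicol 2019, Prop. 3.1, the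
bounds (3.2) `‖u(t)‖_{N+α} ≤ C_N ‖u₀‖_{N+α}` for `|t| ≤ T`, `T‖u₀‖_{1+α} ≤ c(α)`, in a priori
form for every smooth solution) is proved here:

* `BDSV.holderCZBound.eulerHolderPropagation` :
  `BDSV.holderCZBound → Torus.eulerHolderPropagation` (reduction to the boundedness of the second
  Riesz transforms on `C^α(T³)`, BDSV App. C, Prop. C.1, the analytic input of the printed proof);
* `Torus.eulerHolderPropagation_holds : Torus.eulerHolderPropagation` (discharge, feeding in the
  tree's proof `BDSV.holderCZBound_holds` of Prop. C.1, `OnsagerBDSVPotentialTheoryProofs.lean`).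

The a priori estimate itself — pressure equation, Schauder bound for `∇p`, the differentiated
transport equations, the `C^α` transport estimate (B.2), the continuity argument at level `1` and
absorption at the higher levels — is the tree's `BDSV.holderCZBound.eulerApriori`
(`OnsagerBDSVEulerApriori.lean`), which is stated in BDSV's dimensionless form: data
`‖v(t₀)‖_{N',α} ≤ U Λ^{N'-1}` for **all** `1 ≤ N' ≤ N`, life span `(b - a) U ≤ c(α, N)`, conclusion
`‖v(t)‖_{N',α} ≤ C U Λ^{N'-1}`. Passing to the form of `Torus.eulerHolderPropagation` (data at the
levels `1` and `N` only, a life span `c(α)` independent of `N`, conclusion linear in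
`‖u₀‖_{N+α}`) requires two further classical steps, carried out here:

1. **interpolation** (BDSV App. A (A.4)): the intermediate norms of the datum lie below the
   geometric interpolant of the two extreme ones (`Torus.eContDiffHolderNorm_le_geometric`,
   `HolderLogConvexity.lean`), so the dimensionless hypothesis holds with `U ≍ ‖u₀‖_{1+α}`,
   `U Λ^{N-1} ≍ ‖u₀‖_{N+α}`;
2. **iteration in time** ("Grönwall"): the level-`N` estimate, valid on windows of length
   `c(α,N)/U`, is restarted `m = m(α, N)` times from the uniform level-`1` bound to cover the
   whole life span `c(α)/‖u₀‖_{1+α}` (`BDSV.holderCZBound.eulerApriori_restart`), the data at each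
   restart being re-interpolated between the uniform level-`1` bound and the current level-`N`
   bound; the constants stay independent of the solution.

Degenerate data (`u₀ = 0`) are handled by uniqueness (`Torus.IsEulerReynoldsOn.unique`: the
solution is then identically zero).

## References

* T. Buckmaster, C. De Lellis, L. Székelyhidi Jr., V. Vicol, *Onsager's conjecture for admissible
  weak solutions*, Comm. Pure Appl. Math. 72 (2019) 229–274 = arXiv:1701.08678: Prop. 3.1, (3.2)
  and its proof ("(3.2) follows by applying (B.1) and Grönwall's inequality"), App. A (A.4),
  App. C Prop. C.1. [`BuckmasterEtAl2018`]
-/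

noncomputable section

open MeasureTheory Set Filter Function
open scoped NNReal ENNReal ContDiff Topology

namespace Literature.Analysis.FluidPDE

open FunctionSpaces FunctionSpaces.Torus

namespace BDSV

/-! ## One restart of the level-`N` a priori estimate -/

/-- **Restarting the level-`N` a priori estimate from interpolated data.** Suppose the level-`N`
a priori estimate in BDSV's dimensionless form holds with constants `c_N, C_N` (the conclusion of
`BDSV.holderCZBound.eulerApriori`), `N ≥ 2`. Let `(v, p)` be a smooth exact Euler solution on
`[a,b] × T³` with the uniform level-`1` bound `‖v(t)‖_{1,α} ≤ L₁` (`L₁ > 0`), and let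
`[a',b'] ⊆ [a,b]` be a window containing `s₀` with `‖v(s₀)‖_{N,α} ≤ B`, `B ≥ L₁`, of length
`(b' - a') G(N) L₁ ≤ c_N`. Then `‖v(t)‖_{N,α} ≤ C_N G(N) B` on `[a',b']`: the data at `s₀` are
interpolated geometrically (`Torus.eContDiffHolderNorm_le_geometric` with `U = G(N) L₁`,
`Λ = (B/L₁)^{1/(N-1)} ≥ 1`) and the estimate is applied to the restricted solution.
[cite: BuckmasterEtAl2018, Prop. 3.1 (3.2), proof] -/
theorem eulerApriori_restart {α : ℝ≥0} (hα1 : α ≤ 1) {N : ℕ} (hN : 2 ≤ N) {cN CN : ℝ}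
    (hAP : ∀ {a b : ℝ} (_ : a < b) {v : ℝ → UnitAddTorus (Fin 3) → EuclideanSpace ℝ (Fin 3)} {p : ℝ → UnitAddTorus (Fin 3) → ℝ}
      (_ : IsExactEulerOn (Icc a b) v p) {t₀ : ℝ} (_ : t₀ ∈ Icc a b) {U Λ : ℝ} (_ : 0 < U)
      (_ : 1 ≤ Λ) (_ : ∀ N', 1 ≤ N' → N' ≤ N →
        Torus.eContDiffHolderNorm N' α (v t₀) ≤ ENNReal.ofReal (U * Λ ^ (N' - 1)))
      (_ : (b - a) * U ≤ cN),
      ∀ t ∈ Icc a b, ∀ N', 1 ≤ N' → N' ≤ N →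
        Torus.eContDiffHolderNorm N' α (v t) ≤ ENNReal.ofReal (CN * U * Λ ^ (N' - 1)))
    {a b : ℝ} {v : ℝ → UnitAddTorus (Fin 3) → EuclideanSpace ℝ (Fin 3)} {p : ℝ → UnitAddTorus (Fin 3) → ℝ} (h : IsExactEulerOn (Icc a b) v p)
    {L₁ : ℝ} (hL₁ : 0 < L₁)
    (hlev1 : ∀ t ∈ Icc a b, Torus.eContDiffHolderNorm 1 α (v t) ≤ ENNReal.ofReal L₁)
    {a' b' s₀ : ℝ} (ha'b' : a' < b') (hsub : Icc a' b' ⊆ Icc a b) (hs₀ : s₀ ∈ Icc a' b')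
    {B : ℝ} (hB : L₁ ≤ B) (hvB : Torus.eContDiffHolderNorm N α (v s₀) ≤ ENNReal.ofReal B)
    (hsmall : (b' - a') * (((8 * ((N : ℝ) + 3) ^ 2) ^ (2 * (N - 1) ^ 2)) * L₁) ≤ cN) :
    ∀ t ∈ Icc a' b', Torus.eContDiffHolderNorm N α (v t) ≤ ENNReal.ofReal (CN * ((8 * ((N : ℝ) + 3) ^ 2) ^ (2 * (N - 1) ^ 2)) * B) := by
  have hB0 : 0 < B := hL₁.trans_le hB
  have hG1 : (1 : ℝ) ≤ (8 * ((N : ℝ) + 3) ^ 2) ^ (2 * (N - 1) ^ 2) := by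
    refine one_le_pow₀ ?_
    have : (3 : ℝ) ≤ (N : ℝ) + 3 := by linarith [Nat.cast_nonneg (α := ℝ) N]
    nlinarith
  have hG0 : (0 : ℝ) < (8 * ((N : ℝ) + 3) ^ 2) ^ (2 * (N - 1) ^ 2) := zero_lt_one.trans_le hG1
  -- the restricted solution and the interpolated data at `s₀`
  have h' : IsExactEulerOn (Icc a' b') v p := Torus.IsEulerReynoldsOn.restrict h hsub (uniqueDiffOn_Icc ha'b')
  have hvs₀ : IsSmooth (v s₀) := h.smooth_velocity.isSmooth_slice (hsub hs₀)
  set Λ : ℝ := (B / L₁) ^ ((N - 1 : ℕ) : ℝ)⁻¹ with hΛdef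
  have hBL : 1 ≤ B / L₁ := (one_le_div hL₁).2 hB
  have hΛ1 : 1 ≤ Λ := Real.one_le_rpow hBL (by positivity)
  have hΛ0 : 0 ≤ Λ := zero_le_one.trans hΛ1
  have hΛpow : Λ ^ (N - 1) = B / L₁ :=
    Real.rpow_inv_natCast_pow (zero_le_one.trans hBL) (by omega)
  have hdata : ∀ N', 1 ≤ N' → N' ≤ N →
      Torus.eContDiffHolderNorm N' α (v s₀) ≤ ENNReal.ofReal (((8 * ((N : ℝ) + 3) ^ 2) ^ (2 * (N - 1) ^ 2)) * L₁ * Λ ^ (N' - 1)) := by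
    intro N' h1 h2
    exact Torus.eContDiffHolderNorm_le_geometric hN hvs₀ hα1 hL₁ hΛ0 (hlev1 s₀ (hsub hs₀)) hvB
      (le_of_eq (by rw [hΛpow, ← mul_div_assoc, mul_comm L₁ B, mul_div_assoc, div_self hL₁.ne',
        mul_one])) h1 h2
  have hGB : ((8 * ((N : ℝ) + 3) ^ 2) ^ (2 * (N - 1) ^ 2)) * L₁ * (B / L₁) = ((8 * ((N : ℝ) + 3) ^ 2) ^ (2 * (N - 1) ^ 2)) * B := by
    rw [mul_assoc, ← mul_div_assoc, mul_comm L₁ B, mul_div_assoc, div_self hL₁.ne', mul_one]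
  intro t ht
  have hres := hAP ha'b' h' hs₀ (mul_pos hG0 hL₁) hΛ1 hdata hsmall t ht N (by omega) le_rfl
  refine hres.trans (le_of_eq ?_)
  congr 1
  rw [hΛpow, mul_assoc CN, hGB, ← mul_assoc]

/-! ## Chaining the restarts over a fixed number of windows -/

/-- **Iterating the level-`N` estimate.** Under the hypotheses of `eulerApriori_restart` on the
constants, for a smooth exact Euler solution on `[a,b] × T³` with the uniform level-`1` bound
`L₁ > 0`, a base point `t₀ ∈ [a,b]`, `‖v(t₀)‖_{N,α} ≤ B₀` with `B₀ ≥ L₁`, and a number of windows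
`m ≥ 1` with `(b - a) G(N) L₁ ≤ m c_N`: for all `t ∈ [a,b]`,
`‖v(t)‖_{N,α} ≤ (C_N G(N))^m B₀` (induction over the windows
`[t₀ + i(b-t₀)/m, t₀ + (i+1)(b-t₀)/m]` and `[t₀ - (i+1)(t₀-a)/m, t₀ - i(t₀-a)/m]`; this is the
Grönwall step of BDSV's proof of (3.2), with constants independent of the solution).
[cite: BuckmasterEtAl2018, Prop. 3.1 (3.2), proof] -/
theorem eulerApriori_chain {α : ℝ≥0} (hα1 : α ≤ 1) {N : ℕ} (hN : 2 ≤ N) {cN CN : ℝ}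
    (hCN : 1 ≤ CN)
    (hAP : ∀ {a b : ℝ} (_ : a < b) {v : ℝ → UnitAddTorus (Fin 3) → EuclideanSpace ℝ (Fin 3)} {p : ℝ → UnitAddTorus (Fin 3) → ℝ}
      (_ : IsExactEulerOn (Icc a b) v p) {t₀ : ℝ} (_ : t₀ ∈ Icc a b) {U Λ : ℝ} (_ : 0 < U)
      (_ : 1 ≤ Λ) (_ : ∀ N', 1 ≤ N' → N' ≤ N →
        Torus.eContDiffHolderNorm N' α (v t₀) ≤ ENNReal.ofReal (U * Λ ^ (N' - 1)))
      (_ : (b - a) * U ≤ cN),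
      ∀ t ∈ Icc a b, ∀ N', 1 ≤ N' → N' ≤ N →
        Torus.eContDiffHolderNorm N' α (v t) ≤ ENNReal.ofReal (CN * U * Λ ^ (N' - 1)))
    {a b : ℝ} {v : ℝ → UnitAddTorus (Fin 3) → EuclideanSpace ℝ (Fin 3)} {p : ℝ → UnitAddTorus (Fin 3) → ℝ} (h : IsExactEulerOn (Icc a b) v p)
    {L₁ : ℝ} (hL₁ : 0 < L₁)
    (hlev1 : ∀ t ∈ Icc a b, Torus.eContDiffHolderNorm 1 α (v t) ≤ ENNReal.ofReal L₁)
    {t₀ : ℝ} (ht₀ : t₀ ∈ Icc a b) {B₀ : ℝ} (hB₀ : L₁ ≤ B₀)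
    (hvB₀ : Torus.eContDiffHolderNorm N α (v t₀) ≤ ENNReal.ofReal B₀)
    {m : ℕ} (hm : 1 ≤ m) (hsmall : (b - a) * (((8 * ((N : ℝ) + 3) ^ 2) ^ (2 * (N - 1) ^ 2)) * L₁) ≤ m * cN) :
    ∀ t ∈ Icc a b, Torus.eContDiffHolderNorm N α (v t) ≤
      ENNReal.ofReal ((CN * ((8 * ((N : ℝ) + 3) ^ 2) ^ (2 * (N - 1) ^ 2))) ^ m * B₀) := by
  have hG1 : (1 : ℝ) ≤ (8 * ((N : ℝ) + 3) ^ 2) ^ (2 * (N - 1) ^ 2) := by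
    refine one_le_pow₀ ?_
    have : (3 : ℝ) ≤ (N : ℝ) + 3 := by linarith [Nat.cast_nonneg (α := ℝ) N]
    nlinarith
  set ρ : ℝ := CN * ((8 * ((N : ℝ) + 3) ^ 2) ^ (2 * (N - 1) ^ 2)) with hρ
  have hρ1 : 1 ≤ ρ := one_le_mul_of_one_le_of_one_le hCN hG1
  have hB₀0 : 0 < B₀ := hL₁.trans_le hB₀
  have hm0 : (0 : ℝ) < m := by exact_mod_cast hm
  -- the two step lengths
  set σR : ℝ := (b - t₀) / m with hσR
  set σL : ℝ := (t₀ - a) / m with hσL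
  have hmne : (m : ℝ) ≠ 0 := hm0.ne'
  have hσR0 : 0 ≤ σR := div_nonneg (sub_nonneg.2 ht₀.2) hm0.le
  have hσL0 : 0 ≤ σL := div_nonneg (sub_nonneg.2 ht₀.1) hm0.le
  have hmσR : (m : ℝ) * σR = b - t₀ := by rw [hσR, mul_div_assoc', mul_div_cancel_left₀ _ hmne]
  have hmσL : (m : ℝ) * σL = t₀ - a := by rw [hσL, mul_div_assoc', mul_div_cancel_left₀ _ hmne]
  have hGL0 : 0 ≤ ((8 * ((N : ℝ) + 3) ^ 2) ^ (2 * (N - 1) ^ 2)) * L₁ := mul_nonneg (zero_le_one.trans hG1) hL₁.le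
  -- windows of either length are short enough
  have hwin : ∀ σ : ℝ, σ = σR ∨ σ = σL → σ * (((8 * ((N : ℝ) + 3) ^ 2) ^ (2 * (N - 1) ^ 2)) * L₁) ≤ cN := by
    intro σ hσ
    have hσle : σ ≤ (b - a) / m := by
      rcases hσ with rfl | rfl
      · exact div_le_div_of_nonneg_right (by linarith [ht₀.1]) hm0.le
      · exact div_le_div_of_nonneg_right (by linarith [ht₀.2]) hm0.le
    calc σ * (((8 * ((N : ℝ) + 3) ^ 2) ^ (2 * (N - 1) ^ 2)) * L₁) ≤ (b - a) / m * (((8 * ((N : ℝ) + 3) ^ 2) ^ (2 * (N - 1) ^ 2)) * L₁) := mul_le_mul_of_nonneg_right hσle hGL0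
      _ = (b - a) * (((8 * ((N : ℝ) + 3) ^ 2) ^ (2 * (N - 1) ^ 2)) * L₁) / m := by ring
      _ ≤ m * cN / m := div_le_div_of_nonneg_right hsmall hm0.le
      _ = cN := mul_div_cancel_left₀ _ hmne
  -- induction over the windows, both sides at once
  have hP : ∀ i : ℕ, i ≤ m → ∀ t ∈ Icc (t₀ - i * σL) (t₀ + i * σR),
      Torus.eContDiffHolderNorm N α (v t) ≤ ENNReal.ofReal (ρ ^ i * B₀) := by
    intro i
    induction i with
    | zero =>
      intro _ t ht
      have : t = t₀ := by
        simp only [Nat.cast_zero, zero_mul, sub_zero, add_zero] at ht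
        exact le_antisymm ht.2 ht.1
      rw [this, pow_zero, one_mul]
      exact hvB₀
    | succ i IH =>
      intro hi t ht
      have hIH := IH (Nat.le_of_succ_le hi)
      have hi' : (i : ℝ) + 1 ≤ m := by exact_mod_cast hi
      have hBi : L₁ ≤ ρ ^ i * B₀ := hB₀.trans (le_mul_of_one_le_left hB₀0.le (one_le_pow₀ hρ1))
      have hmono : ENNReal.ofReal (ρ ^ i * B₀) ≤ ENNReal.ofReal (ρ ^ (i + 1) * B₀) :=
        ENNReal.ofReal_le_ofReal (mul_le_mul_of_nonneg_right
          (pow_le_pow_right₀ hρ1 (Nat.le_succ i)) hB₀0.le)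
      have hstep : ENNReal.ofReal (CN * ((8 * ((N : ℝ) + 3) ^ 2) ^ (2 * (N - 1) ^ 2)) * (ρ ^ i * B₀)) = ENNReal.ofReal (ρ ^ (i + 1) * B₀) := by
        congr 1
        rw [hρ, pow_succ]
        ring
      -- the right window `[t₀ + i σR, t₀ + (i+1) σR]` and the left one
      set sR : ℝ := t₀ + i * σR with hsR
      set sL : ℝ := t₀ - i * σL with hsL
      have hsRmem : sR ∈ Icc (t₀ - i * σL) (t₀ + i * σR) :=
        ⟨by rw [hsR]; nlinarith [mul_nonneg (Nat.cast_nonneg (α := ℝ) i) hσL0,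
          mul_nonneg (Nat.cast_nonneg (α := ℝ) i) hσR0], le_rfl⟩
      have hsLmem : sL ∈ Icc (t₀ - i * σL) (t₀ + i * σR) :=
        ⟨le_rfl, by rw [hsL]; nlinarith [mul_nonneg (Nat.cast_nonneg (α := ℝ) i) hσL0,
          mul_nonneg (Nat.cast_nonneg (α := ℝ) i) hσR0]⟩
      have hsRb : sR + σR ≤ b := by
        have : sR + σR = t₀ + (i + 1) * σR := by rw [hsR]; ring
        rw [this]
        have h1 : (i + 1 : ℝ) * σR ≤ m * σR := mul_le_mul_of_nonneg_right hi' hσR0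
        linarith
      have hsLa : a ≤ sL - σL := by
        have : sL - σL = t₀ - (i + 1) * σL := by rw [hsL]; ring
        rw [this]
        have h1 : (i + 1 : ℝ) * σL ≤ m * σL := mul_le_mul_of_nonneg_right hi' hσL0
        linarith
      have hsRa : a ≤ sR := by
        rw [hsR]; nlinarith [ht₀.1, mul_nonneg (Nat.cast_nonneg (α := ℝ) i) hσR0]
      have hsLb : sL ≤ b := by
        rw [hsL]; nlinarith [ht₀.2, mul_nonneg (Nat.cast_nonneg (α := ℝ) i) hσL0]
      -- locate `t`
      by_cases hmid : t ∈ Icc (t₀ - i * σL) (t₀ + i * σR)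
      · exact (hIH t hmid).trans hmono
      rw [mem_Icc, not_and_or, not_le, not_le] at hmid
      rcases hmid with hlt | hgt
      · -- `t` in the new left window `[sL - σL, sL)`
        have htI : t ∈ Icc (sL - σL) sL := by
          refine ⟨?_, hlt.le⟩
          have : sL - σL = t₀ - (↑(i + 1) : ℝ) * σL := by rw [hsL]; push_cast; ring
          rw [this]; exact ht.1
        have hσpos : 0 < σL := by
          rcases hσL0.eq_or_lt with h0 | h0
          · exfalso
            rw [← h0, sub_zero] at htI
            exact absurd htI.1 (not_le.2 hlt)
          · exact h0
        have hwin' : (sL - (sL - σL)) * (((8 * ((N : ℝ) + 3) ^ 2) ^ (2 * (N - 1) ^ 2)) * L₁) ≤ cN := by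
          rw [sub_sub_cancel]; exact hwin σL (Or.inr rfl)
        have hres := eulerApriori_restart hα1 hN hAP h hL₁ hlev1 (a' := sL - σL) (b' := sL)
          (s₀ := sL) (by linarith) (Icc_subset_Icc hsLa hsLb) (right_mem_Icc.2 (by linarith))
          hBi (hIH sL hsLmem) hwin' t htI
        rw [hstep] at hres
        exact hres
      · -- `t` in the new right window `(sR, sR + σR]`
        have htI : t ∈ Icc sR (sR + σR) := by
          refine ⟨hgt.le, ?_⟩
          have : sR + σR = t₀ + (↑(i + 1) : ℝ) * σR := by rw [hsR]; push_cast; ring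
          rw [this]; exact ht.2
        have hσpos : 0 < σR := by
          rcases hσR0.eq_or_lt with h0 | h0
          · exfalso
            rw [← h0, add_zero] at htI
            exact absurd htI.2 (not_le.2 hgt)
          · exact h0
        have hwin' : (sR + σR - sR) * (((8 * ((N : ℝ) + 3) ^ 2) ^ (2 * (N - 1) ^ 2)) * L₁) ≤ cN := by
          rw [add_sub_cancel_left]; exact hwin σR (Or.inl rfl)
        have hres := eulerApriori_restart hα1 hN hAP h hL₁ hlev1 (a' := sR) (b' := sR + σR)
          (s₀ := sR) (by linarith) (Icc_subset_Icc hsRa hsRb) (left_mem_Icc.2 (by linarith))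
          hBi (hIH sR hsRmem) hwin' t htI
        rw [hstep] at hres
        exact hres
  intro t ht
  refine hP m le_rfl t ?_
  rw [hmσL, hmσR, sub_sub_cancel, add_sub_cancel]
  exact ht


/-! ## The reduction -/

/-- **`Torus.eulerHolderPropagation` from the Calderón–Zygmund bound** (BDSV Prop. 3.1, (3.2):
"the higher-order bounds (3.2) are also standard … Using the equation for the pressure
`-Δp = ∇v·∇v` and Schauder estimates … (3.2) follows by applying (B.1) and Grönwall's
inequality"). Given `BDSV.holderCZBound` (App. C, Prop. C.1), for `0 < α < 1` there are
`c = c(α) > 0` and `C_N` such that every smooth solution of the Euler equations on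
`[a,b] ∋ 0`, `[a,b] ⊆ [-T,T]`, with `‖u(0)‖_{1+α} ≤ K`, `TK ≤ c`, `‖u(0)‖_{N+α} ≤ K'` (`N ≥ 1`)
satisfies `‖u(t)‖_{N+α} ≤ C_N K'` on `[a,b]`. Proof: `c = c₁/2` with `c₁` the life-span constant
of the level-`1` estimate `BDSV.holderCZBound.eulerApriori` (`N̄ = 1`), which gives the uniform
bound `‖u(t)‖_{1+α} ≤ C₁ K̂`, `K̂ = min(K, 3^{N-1}K')`; for `N ≥ 2` the level-`N` estimate is
chained over `m(α,N)` windows (`BDSV.eulerApriori_chain`) starting from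
`B₀ = C₁ 3^{N-1} K'`; the datum `u(0) = 0` is treated by uniqueness.
[cite: BuckmasterEtAl2018, Prop. 3.1 (3.2) and proof] -/
theorem holderCZBound.eulerHolderPropagation (hCZ : holderCZBound) :
    Torus.eulerHolderPropagation := by
  intro α hα hα1
  have hα'0 : 0 < Real.toNNReal α := Real.toNNReal_pos.2 hα
  have hα'1 : Real.toNNReal α < 1 := by
    rw [← Real.toNNReal_one]
    exact (Real.toNNReal_lt_toNNReal_iff zero_lt_one).2 hα1
  have hα'le : Real.toNNReal α ≤ 1 := hα'1.le
  -- the dimensionless a priori estimate at every level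
  choose cN hcN CN hCN hAP using fun N => hCZ.eulerApriori hα'0 hα'1 N
  have hG1 : ∀ N : ℕ, (1 : ℝ) ≤ (8 * ((N : ℝ) + 3) ^ 2) ^ (2 * (N - 1) ^ 2) := fun N => by
    refine one_le_pow₀ ?_
    have : (3 : ℝ) ≤ (N : ℝ) + 3 := by linarith [Nat.cast_nonneg (α := ℝ) N]
    nlinarith
  -- the constants of the fact
  set c : ℝ := cN 1 / 2 with hc
  set mW : ℕ → ℕ := fun N => ⌈cN 1 * (((8 * ((N : ℝ) + 3) ^ 2) ^ (2 * (N - 1) ^ 2)) * CN 1) / cN N⌉₊ + 1 with hmW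
  set Cf : ℕ → ℝ := fun N =>
    if N = 1 then CN 1 else (CN N * ((8 * ((N : ℝ) + 3) ^ 2) ^ (2 * (N - 1) ^ 2))) ^ (mW N) * (CN 1 * 3 ^ (N - 1)) with hCf
  refine ⟨c, by rw [hc]; exact half_pos (hcN 1), Cf, ?_⟩
  intro T a b u p hab hTa ha0 h0b hbT hsol K hK hK1 hTK N hN1 K' hK' hKN t ht
  have h0mem : (0 : ℝ) ∈ Icc a b := ⟨ha0, h0b⟩
  have hsolE : IsExactEulerOn (Icc a b) u p := hsol
  have hu0 : IsSmooth (u 0) := hsol.smooth_velocity.isSmooth_slice h0mem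
  -- the degenerate datum `u 0 = 0`: the solution vanishes identically
  by_cases hz : eSupNorm (u 0) = 0
  · have hu00 : u 0 = fun _ => 0 := by
      funext x
      have hx : ‖u 0 x‖ₑ ≤ 0 := hz ▸ enorm_le_eSupNorm (u 0) x
      simpa using hx
    have hut : u t = 0 := by
      have h := (Torus.IsEulerReynoldsOn.unique hsol (Torus.isEulerReynoldsOn_zero (Icc a b)) hab
        h0mem hu00 ht).1
      rw [h]
      rfl
    rw [hut, Torus.eContDiffHolderNorm_zero_fun]
    exact bot_le
  -- nondegenerate: `K, K' > 0`
  have hpos_of_le : ∀ {M : ℝ} {j : ℕ}, 0 ≤ M →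
      Torus.eContDiffHolderNorm j (Real.toNNReal α) (u 0) ≤ ENNReal.ofReal M → 0 < M := by
    intro M j hM0 hM
    by_contra hneg
    have hM' : M = 0 := le_antisymm (not_lt.1 hneg) hM0
    rw [hM', ENNReal.ofReal_zero] at hM
    exact hz (le_antisymm ((Torus.eSupNorm_le_eContDiffHolderNorm j (Real.toNNReal α) (u 0)).trans hM) bot_le)
  have hKpos : 0 < K := hpos_of_le hK hK1
  have hK'pos : 0 < K' := hpos_of_le hK' hKN
  -- the sharpened level-`1` bound `K̂ = min K (3^{N-1} K')`
  set Kh : ℝ := min K (3 ^ (N - 1) * K') with hKh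
  have hKh0 : 0 < Kh := lt_min hKpos (by positivity)
  have hKhK : Kh ≤ K := min_le_left _ _
  have hKhK' : Kh ≤ 3 ^ (N - 1) * K' := min_le_right _ _
  have hu0Kh : Torus.eContDiffHolderNorm 1 (Real.toNNReal α) (u 0) ≤ ENNReal.ofReal Kh := by
    rcases le_total K (3 ^ (N - 1) * K') with h | h
    · rw [hKh, min_eq_left h]; exact hK1
    · rw [hKh, min_eq_right h]
      calc Torus.eContDiffHolderNorm 1 (Real.toNNReal α) (u 0)
          ≤ 3 ^ (N - 1) * Torus.eContDiffHolderNorm N (Real.toNNReal α) (u 0) :=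
            eContDiffHolderNorm_le_pow_mul_of_le hu0 hα'le hN1
        _ ≤ 3 ^ (N - 1) * ENNReal.ofReal K' := mul_le_mul' le_rfl hKN
        _ = ENNReal.ofReal (3 ^ (N - 1) * K') := by
            rw [ENNReal.ofReal_mul (by positivity), ENNReal.ofReal_pow (by norm_num),
              ENNReal.ofReal_ofNat]
  -- smallness on the whole interval at level `1`
  have hba : (b - a) * Kh ≤ cN 1 := by
    have h2T : b - a ≤ 2 * T := by linarith
    calc (b - a) * Kh ≤ 2 * T * K := mul_le_mul h2T hKhK hKh0.le (by linarith)
      _ = 2 * (T * K) := by ring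
      _ ≤ 2 * c := by linarith
      _ = cN 1 := by rw [hc]; ring
  -- the uniform level-`1` bound `‖u(s)‖_{1,α} ≤ C₁ K̂`
  have hlev1 : ∀ s ∈ Icc a b,
      Torus.eContDiffHolderNorm 1 (Real.toNNReal α) (u s) ≤ ENNReal.ofReal (CN 1 * Kh) := by
    intro s hs
    have hdata : ∀ N', 1 ≤ N' → N' ≤ 1 →
        Torus.eContDiffHolderNorm N' (Real.toNNReal α) (u 0) ≤
          ENNReal.ofReal (Kh * (1 : ℝ) ^ (N' - 1)) := by
      intro N' h1 h2
      obtain rfl : N' = 1 := le_antisymm h2 h1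
      simpa using hu0Kh
    have h := hAP 1 hab hsolE h0mem hKh0 le_rfl hdata hba s hs 1 le_rfl le_rfl
    simpa using h
  rcases hN1.eq_or_lt with hN | hN2
  · -- `N = 1`
    subst hN
    have hKhK'' : Kh ≤ K' := by simpa using hKhK'
    have hC1 : Cf 1 = CN 1 := by rw [hCf]; simp
    rw [hC1]
    refine (hlev1 t ht).trans (ENNReal.ofReal_le_ofReal ?_)
    exact mul_le_mul_of_nonneg_left hKhK'' (zero_le_one.trans (hCN 1))
  · -- `N ≥ 2`: chain the level-`N` estimate over `mW N` windows
    have hN2' : 2 ≤ N := hN2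
    set L₁ : ℝ := CN 1 * Kh with hL₁
    have hL₁0 : 0 < L₁ := mul_pos (zero_lt_one.trans_le (hCN 1)) hKh0
    set B₀ : ℝ := CN 1 * 3 ^ (N - 1) * K' with hB₀
    have hB₀L : L₁ ≤ B₀ := by
      rw [hL₁, hB₀, mul_assoc]
      exact mul_le_mul_of_nonneg_left hKhK' (zero_le_one.trans (hCN 1))
    have hvB₀ : Torus.eContDiffHolderNorm N (Real.toNNReal α) (u 0) ≤ ENNReal.ofReal B₀ := by
      refine hKN.trans (ENNReal.ofReal_le_ofReal ?_)
      rw [hB₀]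
      have h13 : (1 : ℝ) ≤ CN 1 * 3 ^ (N - 1) :=
        one_le_mul_of_one_le_of_one_le (hCN 1) (one_le_pow₀ (by norm_num))
      exact le_mul_of_one_le_left hK' h13
    have hm1 : 1 ≤ mW N := Nat.le_add_left 1 _
    have hsmallN : (b - a) * (((8 * ((N : ℝ) + 3) ^ 2) ^ (2 * (N - 1) ^ 2)) * L₁) ≤ (mW N) * cN N := by
      have hG0 : (0 : ℝ) ≤ (8 * ((N : ℝ) + 3) ^ 2) ^ (2 * (N - 1) ^ 2) := zero_le_one.trans (hG1 N)
      have h1 : (b - a) * (((8 * ((N : ℝ) + 3) ^ 2) ^ (2 * (N - 1) ^ 2)) * L₁) ≤ cN 1 * (((8 * ((N : ℝ) + 3) ^ 2) ^ (2 * (N - 1) ^ 2)) * CN 1) := by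
        calc (b - a) * (((8 * ((N : ℝ) + 3) ^ 2) ^ (2 * (N - 1) ^ 2)) * L₁) = ((b - a) * Kh) * (((8 * ((N : ℝ) + 3) ^ 2) ^ (2 * (N - 1) ^ 2)) * CN 1) := by rw [hL₁]; ring
          _ ≤ cN 1 * (((8 * ((N : ℝ) + 3) ^ 2) ^ (2 * (N - 1) ^ 2)) * CN 1) :=
              mul_le_mul_of_nonneg_right hba (mul_nonneg hG0 (zero_le_one.trans (hCN 1)))
      have h2 : cN 1 * (((8 * ((N : ℝ) + 3) ^ 2) ^ (2 * (N - 1) ^ 2)) * CN 1) ≤ (mW N) * cN N := by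
        have hceil : cN 1 * (((8 * ((N : ℝ) + 3) ^ 2) ^ (2 * (N - 1) ^ 2)) * CN 1) / cN N ≤ (mW N : ℝ) := by
          rw [hmW]
          push_cast
          exact (Nat.le_ceil _).trans (by linarith)
        rwa [div_le_iff₀ (hcN N)] at hceil
      exact h1.trans h2
    have hchain := eulerApriori_chain hα'le hN2' (hCN N) (hAP N) hsolE hL₁0 hlev1 h0mem hB₀L
      hvB₀ hm1 hsmallN t ht
    refine hchain.trans (le_of_eq ?_)
    congr 1
    have hC : Cf N = (CN N * ((8 * ((N : ℝ) + 3) ^ 2) ^ (2 * (N - 1) ^ 2))) ^ (mW N) * (CN 1 * 3 ^ (N - 1)) := by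
      rw [hCf]
      simp [show N ≠ 1 by omega]
    rw [hC, hB₀]
    ring

end BDSV

/-! ## The discharge -/

namespace Torus

/-- **Discharge of `Torus.eulerHolderPropagation`** (BDSV 2019, Prop. 3.1, the a priori bounds
(3.2) `‖u(t)‖_{N+α} ≤ C_N‖u₀‖_{N+α}`, `N ≥ 1`, for `|t| ≤ T`, `T‖u₀‖_{1+α} ≤ c(α)`): the
reduction `BDSV.holderCZBound.eulerHolderPropagation` fed with the tree's proof of the
Calderón–Zygmund bound `BDSV.holderCZBound_holds` (App. C, Prop. C.1).
[cite: BuckmasterEtAl2018, Prop. 3.1 (3.2)] -/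
theorem eulerHolderPropagation_holds : eulerHolderPropagation :=
  BDSV.holderCZBound.eulerHolderPropagation BDSV.holderCZBound_holds

end Torus

end Literature.Analysis.FluidPDE
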